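import Summits.RiemannHypothesis.RiemannHypothesis.Theorems.WeilFormatCEntryArchIntegrals
import Literature.NumberTheory.LFunctions.WeilArchDensityPanels
import Literature.NumberTheory.LFunctions.TauberianProofs
import HarnessLib

/-!
# Format C, entry theorem (L-C1) — V: the archimedean integrals of the window kernels in closed form

Helper file of the rh-explicit Weil-positivity programme (`--supports stmt-RiemannHypothesis-0098`; seat
rh-explicit-weil-2), RH-free, no definitions, no named facts.  Continues `WeilFormatCEntryArchIntegrals.lean`.

With `ρ(t) = e^{t/2}/(2 sinh t) = Σ_k e^{−l_k t}` (`l_k = 2k + ½`) and a kernel `K` continuous on `[0, T]` with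
`|K(t)| ≤ Ct`, the integral `∫_{(0,T]} ρ K` is the absolutely convergent sum of the term integrals
(`hasSum_setIntegral_exp_mul`: the `k`-th term is `≤ C/l_k²`; Mathlib's `hasSum_integral_of_summable_integral_norm`),
and likewise for the tail `∫_{(T,∞)} ρ` (`hasSum_setIntegral_Ioi_exp`).  Applied to the two kernels of the increment
form of a trigonometric window (`WeilFormatCEntryIncrement.lean`) on `T = 2a`, `ω_n = πn/a` (`ω_n T = 2πn`):

* `setIntegral_weilArchDensity_mul_sin`:
  `∫_{(0,2a]} ρ(t) sin(ω_m t) dt = ½ Im ψ(¼ + iω_m/2) − Σ_k e^{−2a l_k} ω_m/(l_k² + ω_m²)`;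
* `setIntegral_weilArchDensity_mul_diag`:
  `∫_{(0,2a]} ρ(t)(2 − 2(1 − t/2a)cos ω_n t) dt + ∫_{(2a,∞)} 2ρ(t) dt
     = (Re ψ(¼ + iω_n/2) − ψ(¼)) + Re ψ′(¼ + iω_n/2)/(4a) − (1/a)Σ_k e^{−2a l_k}(l_k² − ω_n²)/(l_k² + ω_n²)²`

— the digamma terms and the "rapidly convergent" exponential sums of Yoshida's (5.13)–(5.16), obtained here on the
position side (Bombieri's density) instead of by shifting the contour in (5.9).

References: H. Yoshida, Adv. Stud. Pure Math. 21 (1992) 281–325, §5 pp. 298–301 [Yoshida1992HermitianForms];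
E. Bombieri, Rend. Mat. Acc. Lincei (9) 11 (2000), Thm 2 [Bombieri2000Weil].
-/

set_option linter.dupNamespace false

noncomputable section

open Complex Set MeasureTheory Finset
open scoped Real ComplexConjugate BigOperators Topology

namespace Summit.RiemannHypothesis.RiemannHypothesis.Theorems.WeilFormatC

open Literature.NumberTheory.LFunctions Literature.Analysis.SpecialFunctions

/-! ## Term-wise integration of the density against a kernel vanishing linearly at `0` -/

/-- `t·ρ(t) ≤ t + ½` for `t > 0` (`ρ = weilArchDensity`). -/
theorem mul_weilArchDensity_le {t : ℝ} (ht : 0 < t) : t * weilArchDensity t ≤ t + 1 / 2 := by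
  have h := weilArchDensityG_le ht.le
  rwa [weilArchDensityG_of_ne ht.ne'] at h

/-- `Σ_k 1/l_k²` converges (`l_k = 2k + ½ ≥ (k+1)/2`). -/
theorem summable_one_div_digammaNode_sq : Summable (fun k : ℕ ↦ 1 / digammaNode k ^ 2) := by
  have h2 : Summable (fun k : ℕ ↦ 1 / ((k : ℝ) + 1) ^ 2) := by
    have h := (Real.summable_one_div_nat_pow.2 one_lt_two)
    exact_mod_cast (summable_nat_add_iff 1).2 h
  refine (h2.mul_left 4).of_nonneg_of_le (fun k ↦ by have := digammaNode_pos k; positivity) fun k ↦ ?_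
  have hk : 0 < (k : ℝ) + 1 := by positivity
  have hl : ((k : ℝ) + 1) / 2 ≤ digammaNode k := by
    rw [digammaNode]; linarith [(Nat.cast_nonneg k : (0 : ℝ) ≤ k)]
  have hl2 : (((k : ℝ) + 1) / 2) ^ 2 ≤ digammaNode k ^ 2 := pow_le_pow_left₀ (by positivity) hl 2
  rw [show 4 * (1 / ((k : ℝ) + 1) ^ 2) = 1 / (((k : ℝ) + 1) / 2) ^ 2 by field_simp; ring]
  exact one_div_le_one_div_of_le (by positivity) hl2

/-- `∫_0^T t e^{−lt} dt ≤ 1/l²` (`l > 0`, `T ≥ 0`). -/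
theorem integral_mul_exp_neg_le {l : ℝ} (hl : 0 < l) {T : ℝ} (hT : 0 ≤ T) :
    ∫ t in (0 : ℝ)..T, t * Real.exp (-(l * t)) ≤ 1 / l ^ 2 := by
  have h := integral_mul_exp_neg_mul_cos (l := l) (ω := 0) (T := T) (m := 0) (by simp) (by positivity)
  simp only [zero_mul, Real.cos_zero, mul_one] at h
  rw [h]
  have hE : 0 < Real.exp (-(l * T)) := Real.exp_pos _
  have e1 : (l ^ 2 - 0 ^ 2) * (1 - Real.exp (-(l * T))) / (l ^ 2 + 0 ^ 2) ^ 2 -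
      T * Real.exp (-(l * T)) * l / (l ^ 2 + 0 ^ 2) =
      1 / l ^ 2 - (Real.exp (-(l * T)) / l ^ 2 + T * Real.exp (-(l * T)) / l) := by
    field_simp; ring
  rw [e1]
  have : 0 ≤ Real.exp (-(l * T)) / l ^ 2 + T * Real.exp (-(l * T)) / l := by positivity
  linarith

/-- **Term-wise integration on the window scale.**  If `K` is continuous on `[0, T]` and `|K(t)| ≤ C t` on `(0,T]`,
then `Σ_k ∫_{(0,T]} e^{−l_k t} K(t) dt = ∫_{(0,T]} ρ(t) K(t) dt` (absolutely convergent: the `k`-th term is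
`≤ C/l_k²`). -/
theorem hasSum_setIntegral_exp_mul {T : ℝ} (hT : 0 < T) {K : ℝ → ℝ} {C : ℝ} (hK : ContinuousOn K (Icc 0 T))
    (hKb : ∀ t ∈ Ioc 0 T, |K t| ≤ C * t) :
    HasSum (fun k : ℕ ↦ ∫ t in Ioc 0 T, Real.exp (-(digammaNode k * t)) * K t)
      (∫ t in Ioc 0 T, weilArchDensity t * K t) := by
  have hC : 0 ≤ C := by
    have h := hKb T ⟨hT, le_rfl⟩
    nlinarith [abs_nonneg (K T)]
  have hcont : ∀ k : ℕ, ContinuousOn (fun t ↦ Real.exp (-(digammaNode k * t)) * K t) (Icc 0 T) := fun k ↦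
    (by fun_prop : Continuous fun t : ℝ ↦ Real.exp (-(digammaNode k * t))).continuousOn.mul hK
  have hF_int : ∀ k : ℕ, Integrable (fun t ↦ Real.exp (-(digammaNode k * t)) * K t) (volume.restrict (Ioc 0 T)) :=
    fun k ↦ ((hcont k).integrableOn_Icc).mono_set Ioc_subset_Icc_self
  have hF_sum : Summable fun k : ℕ ↦ ∫ t in Ioc 0 T, ‖Real.exp (-(digammaNode k * t)) * K t‖ := by
    refine (summable_one_div_digammaNode_sq.mul_left C).of_nonneg_of_le
      (fun k ↦ integral_nonneg fun _ ↦ norm_nonneg _) fun k ↦ ?_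
    have hl := digammaNode_pos k
    have hmaj : IntegrableOn (fun t ↦ C * (t * Real.exp (-(digammaNode k * t)))) (Ioc 0 T) :=
      ((by fun_prop : Continuous fun t : ℝ ↦ C * (t * Real.exp (-(digammaNode k * t)))).continuousOn.integrableOn_Icc).mono_set
        Ioc_subset_Icc_self
    calc ∫ t in Ioc 0 T, ‖Real.exp (-(digammaNode k * t)) * K t‖
        ≤ ∫ t in Ioc 0 T, C * (t * Real.exp (-(digammaNode k * t))) := by
          refine setIntegral_mono_on (hF_int k).norm hmaj measurableSet_Ioc fun t ht ↦ ?_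
          rw [norm_mul, Real.norm_of_nonneg (Real.exp_pos _).le, Real.norm_eq_abs]
          have := hKb t ht
          have hE : 0 < Real.exp (-(digammaNode k * t)) := Real.exp_pos _
          nlinarith
      _ = C * ∫ t in (0 : ℝ)..T, t * Real.exp (-(digammaNode k * t)) := by
          rw [MeasureTheory.integral_const_mul, intervalIntegral.integral_of_le hT.le]
      _ ≤ C * (1 / digammaNode k ^ 2) :=
          mul_le_mul_of_nonneg_left (integral_mul_exp_neg_le hl hT.le) hC
  have h := hasSum_integral_of_summable_integral_norm hF_int hF_sum
  have heq : (∫ t in Ioc 0 T, ∑' k : ℕ, Real.exp (-(digammaNode k * t)) * K t) =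
      ∫ t in Ioc 0 T, weilArchDensity t * K t := by
    refine setIntegral_congr_fun measurableSet_Ioc fun t ht ↦ ?_
    rw [tsum_mul_right, (hasSum_exp_neg_digammaNode_mul ht.1).tsum_eq]
  rwa [heq] at h

/-- **Term-wise integration of the tail**: `Σ_k ∫_{(T,∞)} e^{−l_k t} dt = ∫_{(T,∞)} ρ(t) dt` (`T > 0`). -/
theorem hasSum_setIntegral_Ioi_exp {T : ℝ} (hT : 0 < T) :
    HasSum (fun k : ℕ ↦ ∫ t in Ioi T, Real.exp (-(digammaNode k * t)))
      (∫ t in Ioi T, weilArchDensity t) := by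
  have hF_int : ∀ k : ℕ, Integrable (fun t ↦ Real.exp (-(digammaNode k * t))) (volume.restrict (Ioi T)) := by
    intro k
    have h := integrableOn_exp_mul_Ioi (a := -digammaNode k) (by linarith [digammaNode_pos k]) T
    refine h.congr_fun (fun t _ ↦ by simp only [neg_mul]) measurableSet_Ioi
  have hval : ∀ k : ℕ, ∫ t in Ioi T, ‖Real.exp (-(digammaNode k * t))‖ =
      Real.exp (-(2 * (T / 2) * digammaNode k)) * (1 / digammaNode k) := by
    intro k
    rw [show (fun t ↦ ‖Real.exp (-(digammaNode k * t))‖) = fun t ↦ Real.exp (-(digammaNode k * t)) by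
      funext t; exact Real.norm_of_nonneg (Real.exp_pos _).le,
      Literature.NumberTheory.LFunctions.SchmidtTauberian.integral_exp_neg_Ioi' (digammaNode_pos k) T]
    rw [div_eq_mul_one_div]
    congr 2
    ring
  have hF_sum : Summable fun k : ℕ ↦ ∫ t in Ioi T, ‖Real.exp (-(digammaNode k * t))‖ := by
    simp_rw [hval]
    exact summable_exp_neg_mul_of_bounded (half_pos hT) (b := fun k ↦ 1 / digammaNode k) (C := 2) fun k ↦ by
      have hl := one_half_le_digammaNode k
      have hlpos := digammaNode_pos k
      rw [abs_of_pos (by positivity), div_le_iff₀ hlpos]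
      linarith
  have h := hasSum_integral_of_summable_integral_norm hF_int hF_sum
  have heq : (∫ t in Ioi T, ∑' k : ℕ, Real.exp (-(digammaNode k * t))) = ∫ t in Ioi T, weilArchDensity t := by
    refine setIntegral_congr_fun measurableSet_Ioi fun t ht ↦ ?_
    exact (hasSum_exp_neg_digammaNode_mul (hT.trans ht)).tsum_eq
  rwa [heq] at h

/-! ## The off-diagonal archimedean integral `∫_{(0,2a]} ρ(t) sin(ω_m t) dt` -/

/-- `|sin(ωt)| ≤ |ω| t` for `t ≥ 0`. -/
theorem abs_sin_mul_le {ω t : ℝ} (ht : 0 ≤ t) : |Real.sin (ω * t)| ≤ |ω| * t := by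
  have h := Real.abs_sin_le_abs (x := ω * t)
  rwa [abs_mul, abs_of_nonneg ht] at h

/-- **`∫_{(0,2a]} ρ(t) sin(ω_m t) dt = ½ Im ψ(¼ + iω_m/2) − Σ_k e^{−2a l_k} ω_m/(l_k² + ω_m²)`**, `ω_m = πm/a`
(`a > 0`; uses `sin(2aω_m) = 0`, `cos(2aω_m) = 1`). -/
theorem setIntegral_weilArchDensity_mul_sin {a : ℝ} (ha : 0 < a) (m : ℤ) :
    ∫ t in Ioc 0 (2 * a), weilArchDensity t * Real.sin (π * m / a * t) =
      (Complex.digamma (1 / 4 + ((π * m / a : ℝ) : ℂ) / 2 * I)).im / 2 -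
        ∑' k : ℕ, Real.exp (-(2 * a * digammaNode k)) * ((π * m / a) / (digammaNode k ^ 2 + (π * m / a) ^ 2)) := by
  set ω : ℝ := π * m / a with hω
  have hT : (0 : ℝ) < 2 * a := by positivity
  have hωT : ω * (2 * a) = 2 * π * m := by rw [hω]; field_simp
  -- term-wise integration
  have h1 := hasSum_setIntegral_exp_mul hT (K := fun t ↦ Real.sin (ω * t)) (C := |ω|)
    (by fun_prop) (fun t ht ↦ abs_sin_mul_le ht.1.le)
  -- the k-th term in closed form
  have hterm : ∀ k : ℕ, ∫ t in Ioc 0 (2 * a), Real.exp (-(digammaNode k * t)) * Real.sin (ω * t) =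
      ω / (digammaNode k ^ 2 + ω ^ 2) - Real.exp (-(2 * a * digammaNode k)) * (ω / (digammaNode k ^ 2 + ω ^ 2)) := by
    intro k
    have hs : digammaNode k ^ 2 + ω ^ 2 ≠ 0 := by have := digammaNode_pos k; positivity
    rw [← intervalIntegral.integral_of_le hT.le, integral_exp_neg_mul_sin hωT hs,
      show digammaNode k * (2 * a) = 2 * a * digammaNode k by ring]
    field_simp
  simp_rw [hterm] at h1
  -- the two series
  have h2 : HasSum (fun k : ℕ ↦ ω / (digammaNode k ^ 2 + ω ^ 2))
      ((Complex.digamma (1 / 4 + (ω : ℂ) / 2 * I)).im / 2) := by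
    have h := (hasSum_im_digamma_quarter ω).div_const 2
    refine h.congr_fun fun k ↦ ?_
    ring
  have h3 := (summable_s0 ha ω).hasSum
  exact h1.unique (h2.sub h3)

/-! ## The diagonal archimedean integral -/

/-- The diagonal kernel vanishes linearly at `0`: `|2 − 2(1 − t/2a) cos(ωt)| ≤ (2|ω| + 1/a)·t` on `t ≥ 0` (`a > 0`). -/
theorem abs_diag_kernel_le {a : ℝ} (ha : 0 < a) (ω : ℝ) {t : ℝ} (ht : 0 ≤ t) :
    |2 - 2 * (1 - t / (2 * a)) * Real.cos (ω * t)| ≤ (2 * |ω| + 1 / a) * t := by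
  have hcos : |1 - Real.cos (ω * t)| ≤ |ω| * t := by
    have h := Real.abs_cos_sub_cos_le 0 (ω * t)
    rw [Real.cos_zero, zero_sub, abs_neg, abs_mul, abs_of_nonneg ht] at h
    exact h
  have hc1 : |Real.cos (ω * t)| ≤ 1 := Real.abs_cos_le_one _
  have hsplit : 2 - 2 * (1 - t / (2 * a)) * Real.cos (ω * t) =
      2 * (1 - Real.cos (ω * t)) + (t / a) * Real.cos (ω * t) := by
    field_simp; ring
  rw [hsplit]
  calc |2 * (1 - Real.cos (ω * t)) + t / a * Real.cos (ω * t)|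
      ≤ |2 * (1 - Real.cos (ω * t))| + |t / a * Real.cos (ω * t)| := abs_add_le _ _
    _ = 2 * |1 - Real.cos (ω * t)| + t / a * |Real.cos (ω * t)| := by
        rw [abs_mul, abs_mul, abs_of_pos (by norm_num : (0 : ℝ) < 2), abs_of_nonneg (by positivity : 0 ≤ t / a)]
    _ ≤ 2 * (|ω| * t) + t / a * 1 := by gcongr
    _ = (2 * |ω| + 1 / a) * t := by ring

/-- The `k`-th diagonal term in closed form (`l > 0`, `ω·2a ∈ 2πℤ`):
`∫_{(0,2a]} e^{−lt}(2 − 2(1 − t/2a)cos ωt) dt + ∫_{(2a,∞)} 2e^{−lt} dt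
 = (2/l − 2l/(l²+ω²)) + (l² − ω²)/(a(l²+ω²)²) − e^{−2al}(l² − ω²)/(a(l²+ω²)²)`. -/
theorem diag_term_eq {a l ω : ℝ} (ha : 0 < a) (hl : 0 < l) {m : ℤ} (hωT : ω * (2 * a) = 2 * π * m) :
    (∫ t in Ioc 0 (2 * a), Real.exp (-(l * t)) * (2 - 2 * (1 - t / (2 * a)) * Real.cos (ω * t))) +
      (∫ t in Ioi (2 * a), Real.exp (-(l * t)) * 2) =
      digammaTerm l ω + (l ^ 2 - ω ^ 2) / (a * (l ^ 2 + ω ^ 2) ^ 2) -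
        Real.exp (-(2 * a * l)) * ((l ^ 2 - ω ^ 2) / (l ^ 2 + ω ^ 2) ^ 2) / a := by
  have hT : (0 : ℝ) < 2 * a := by positivity
  have hs : l ^ 2 + ω ^ 2 ≠ 0 := by positivity
  -- split the window integrand into the three elementary pieces
  have hpt : ∀ t : ℝ, Real.exp (-(l * t)) * (2 - 2 * (1 - t / (2 * a)) * Real.cos (ω * t)) =
      2 * Real.exp (-(l * t)) - 2 * (Real.exp (-(l * t)) * Real.cos (ω * t)) +
        (1 / a) * (t * Real.exp (-(l * t)) * Real.cos (ω * t)) := by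
    intro t; field_simp; ring
  have i1 : IntervalIntegrable (fun t ↦ 2 * Real.exp (-(l * t))) volume 0 (2 * a) := by
    apply Continuous.intervalIntegrable; fun_prop
  have i2 : IntervalIntegrable (fun t ↦ 2 * (Real.exp (-(l * t)) * Real.cos (ω * t))) volume 0 (2 * a) := by
    apply Continuous.intervalIntegrable; fun_prop
  have i3 : IntervalIntegrable (fun t ↦ (1 / a) * (t * Real.exp (-(l * t)) * Real.cos (ω * t))) volume 0 (2 * a) := by
    apply Continuous.intervalIntegrable; fun_prop
  rw [← intervalIntegral.integral_of_le hT.le]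
  simp_rw [hpt]
  rw [intervalIntegral.integral_add (i1.sub i2) i3, intervalIntegral.integral_sub i1 i2,
    intervalIntegral.integral_const_mul, intervalIntegral.integral_const_mul, intervalIntegral.integral_const_mul,
    integral_exp_neg_mul hl.ne', integral_exp_neg_mul_cos hωT hs, integral_mul_exp_neg_mul_cos hωT hs,
    MeasureTheory.integral_mul_const, Literature.NumberTheory.LFunctions.SchmidtTauberian.integral_exp_neg_Ioi' hl,
    digammaTerm_eq hl, show l * (2 * a) = 2 * a * l by ring]
  field_simp
  ring

/-- **The diagonal archimedean integral in closed form**: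
`∫_{(0,2a]} ρ(t)(2 − 2(1 − t/2a)cos ω_n t) dt + ∫_{(2a,∞)} 2ρ(t) dt
  = (Re ψ(¼ + iω_n/2) − ψ(¼)) + Re ψ′(¼ + iω_n/2)/(4a) − (1/a) Σ_k e^{−2a l_k}(l_k² − ω_n²)/(l_k² + ω_n²)²`,
`ω_n = πn/a` (`a > 0`). -/
theorem setIntegral_weilArchDensity_mul_diag {a : ℝ} (ha : 0 < a) (n : ℤ) :
    (∫ t in Ioc 0 (2 * a), weilArchDensity t * (2 - 2 * (1 - t / (2 * a)) * Real.cos (π * n / a * t))) +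
      (∫ t in Ioi (2 * a), weilArchDensity t * 2) =
      (reDigammaQuarter (π * n / a) - reDigammaQuarter 0) +
        (deriv Complex.digamma (1 / 4 + ((π * n / a : ℝ) : ℂ) / 2 * I)).re / (4 * a) -
        (∑' k : ℕ, Real.exp (-(2 * a * digammaNode k)) *
          ((digammaNode k ^ 2 - (π * n / a) ^ 2) / (digammaNode k ^ 2 + (π * n / a) ^ 2) ^ 2)) / a := by
  set ω : ℝ := π * n / a with hω
  have hT : (0 : ℝ) < 2 * a := by positivity
  have hωT : ω * (2 * a) = 2 * π * n := by rw [hω]; field_simp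
  -- term-wise integration of both pieces
  have h1 := hasSum_setIntegral_exp_mul hT (K := fun t ↦ 2 - 2 * (1 - t / (2 * a)) * Real.cos (ω * t))
    (C := 2 * |ω| + 1 / a) (by fun_prop) (fun t ht ↦ abs_diag_kernel_le ha ω ht.1.le)
  have h2 := (hasSum_setIntegral_Ioi_exp hT).mul_right 2
  rw [← MeasureTheory.integral_mul_const] at h2
  have h12 := h1.add h2
  have hterm : ∀ k : ℕ, (∫ t in Ioc 0 (2 * a), Real.exp (-(digammaNode k * t)) *
      (2 - 2 * (1 - t / (2 * a)) * Real.cos (ω * t))) + (∫ t in Ioi (2 * a), Real.exp (-(digammaNode k * t))) * 2 =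
      digammaTerm (digammaNode k) ω + (digammaNode k ^ 2 - ω ^ 2) / (a * (digammaNode k ^ 2 + ω ^ 2) ^ 2) -
        Real.exp (-(2 * a * digammaNode k)) * ((digammaNode k ^ 2 - ω ^ 2) / (digammaNode k ^ 2 + ω ^ 2) ^ 2) / a := by
    intro k
    rw [← MeasureTheory.integral_mul_const]
    exact diag_term_eq ha (digammaNode_pos k) hωT
  simp_rw [hterm] at h12
  -- the three series
  have s1 := hasSum_digammaTerm ω
  have s2 : HasSum (fun k : ℕ ↦ (digammaNode k ^ 2 - ω ^ 2) / (a * (digammaNode k ^ 2 + ω ^ 2) ^ 2))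
      ((deriv Complex.digamma (1 / 4 + (ω : ℂ) / 2 * I)).re / (4 * a)) := by
    have h := (hasSum_re_deriv_digamma_quarter ω).div_const (4 * a)
    refine h.congr_fun fun k ↦ ?_
    field_simp
  have s3 := ((summable_sdiag ha ω).hasSum).div_const a
  have h := (s1.add s2).sub s3
  exact h12.unique (h.congr_fun fun k ↦ by ring)

end Summit.RiemannHypothesis.RiemannHypothesis.Theorems.WeilFormatC
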